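import Mathlib
import HarnessLib

/-!
# Crux `SelfNormalisedSkewness` (stmt-QuantumFields-18944), line `Sketch`:
# stub `stub_flatNearDisjointSupports` (Schwartz flatness at disjoint supports)

If `f, g` are Schwartz functions on `ℝ⁴` with disjoint topological supports, then at every
point `y` with `g y ≠ 0` the function `f` vanishes to infinite order, with Schwartz decay in `x`:
`|f x| (1 + ‖x‖)^M ≤ C ‖x - y‖^N`, uniformly in `x, y`. The proof is the mean value inequality
iterated `N` times along the segment `[y, x]` (all derivatives of `f` vanish at `y ∉ tsupport f`),
combined with the Schwartz seminorm bounds on `D^N f`. Folklore.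
-/

noncomputable section

open scoped Topology ContDiff
open Set Filter Metric Function

namespace Summit.QuantumFields.YangMills.Theorems.SelfNormalisedSkewness.Negative

local notation "E4" => EuclideanSpace ℝ (Fin 4)

/-- **Flat ⇒ small, uniformly on a segment.** If `F` is smooth, `y ∉ tsupport F`, and
`‖D^m F‖ ≤ B` on the segment `[y, x]`, then `‖D^k F z‖ ≤ B ‖x - y‖^i` on `[y, x]` whenever
`i + k = m` (induction on `i`, mean value inequality on the segment). [folklore] -/
theorem norm_iteratedFDeriv_le_of_notMem_tsupport {E G : Type*} [NormedAddCommGroup E]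
    [NormedSpace ℝ E] [NormedAddCommGroup G] [NormedSpace ℝ G] {F : E → G}
    (hF : ContDiff ℝ ∞ F) {y : E} (hy : y ∉ tsupport F) {m : ℕ} {x : E} {B : ℝ}
    (hB : ∀ z ∈ segment ℝ y x, ‖iteratedFDeriv ℝ m F z‖ ≤ B) :
    ∀ i k : ℕ, i + k = m → ∀ z ∈ segment ℝ y x,
      ‖iteratedFDeriv ℝ k F z‖ ≤ B * ‖x - y‖ ^ i := by
  have hvan : ∀ k, iteratedFDeriv ℝ k F y = 0 := fun k =>
    notMem_support.mp fun h => hy (support_iteratedFDeriv_subset k h)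
  have hseg : ∀ z ∈ segment ℝ y x, ‖z - y‖ ≤ ‖x - y‖ := by
    intro z hz
    have h : z ∈ closedBall y (dist x y) :=
      (convex_closedBall y (dist x y)).segment_subset (mem_closedBall_self dist_nonneg)
        (mem_closedBall.2 le_rfl) hz
    rwa [mem_closedBall, dist_eq_norm, dist_eq_norm] at h
  intro i
  induction i with
  | zero =>
    intro k hk z hz
    rw [zero_add] at hk
    subst hk
    simpa using hB z hz
  | succ i IH =>
    intro k hk z hz
    have hdg : ∀ w ∈ segment ℝ y x, DifferentiableAt ℝ (iteratedFDeriv ℝ k F) w := fun w _ =>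
      hF.differentiable_iteratedFDeriv (by exact_mod_cast ENat.coe_lt_top k) w
    have hbound : ∀ w ∈ segment ℝ y x,
        ‖fderiv ℝ (iteratedFDeriv ℝ k F) w‖ ≤ B * ‖x - y‖ ^ i := by
      intro w hw
      rw [norm_fderiv_iteratedFDeriv]
      exact IH (k + 1) (by omega) w hw
    have hmvt := (convex_segment y x).norm_image_sub_le_of_norm_fderiv_le hdg hbound
      (left_mem_segment ℝ y x) hz
    rw [hvan k, sub_zero] at hmvt
    have hB0 : 0 ≤ B := le_trans (norm_nonneg _) (hB y (left_mem_segment ℝ y x))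
    calc ‖iteratedFDeriv ℝ k F z‖ ≤ B * ‖x - y‖ ^ i * ‖z - y‖ := hmvt
      _ ≤ B * ‖x - y‖ ^ i * ‖x - y‖ :=
        mul_le_mul_of_nonneg_left (hseg z hz) (by positivity)
      _ = B * ‖x - y‖ ^ (i + 1) := by ring

/-- **Schwartz flatness at disjoint supports.** For Schwartz `f, g` on `ℝ⁴` with disjoint
topological supports and `N, M : ℕ`, there is `C ≥ 0` with
`|f x| (1 + ‖x‖)^M ≤ C ‖x - y‖^N` for all `x` and all `y` with `g y ≠ 0`. [folklore] -/
theorem stub_flatNearDisjointSupports (f g : SchwartzMap E4 ℝ) (hfg : Disjoint (tsupport f) (tsupport g)) (N M : ℕ) : ∃ C : ℝ, 0 ≤ C ∧ ∀ x y : E4, g y ≠ 0 → |f x| * (1 + ‖x‖) ^ M ≤ C * ‖x - y‖ ^ N := by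
  obtain ⟨D₁, hD₁⟩ : ∃ D : ℝ, ∀ z : E4, (1 + ‖z‖) ^ M * ‖iteratedFDeriv ℝ N f z‖ ≤ D :=
    ⟨_, fun z =>
      SchwartzMap.one_add_le_sup_seminorm_apply (𝕜 := ℝ) (m := (M, N)) le_rfl le_rfl f z⟩
  obtain ⟨D₀, hD₀⟩ : ∃ D : ℝ, ∀ z : E4, (1 + ‖z‖) ^ M * ‖iteratedFDeriv ℝ 0 f z‖ ≤ D :=
    ⟨_, fun z =>
      SchwartzMap.one_add_le_sup_seminorm_apply (𝕜 := ℝ) (m := (M, 0)) le_rfl le_rfl f z⟩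
  have hD₁0 : 0 ≤ D₁ := le_trans (by positivity) (hD₁ 0)
  have hD₀0 : 0 ≤ D₀ := le_trans (by positivity) (hD₀ 0)
  refine ⟨2 ^ M * D₁ + 2 ^ N * D₀, by positivity, ?_⟩
  intro x y hgy
  have hy : y ∉ tsupport (f : E4 → ℝ) :=
    Set.disjoint_right.mp hfg (subset_tsupport _ (mem_support.mpr hgy))
  have hfx : |f x| * (1 + ‖x‖) ^ M ≤ D₀ := by
    have h := hD₀ x
    rw [norm_iteratedFDeriv_zero, Real.norm_eq_abs, mul_comm] at h
    exact h
  have hxpos : 0 < 1 + ‖x‖ := by positivity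
  rcases le_or_gt ‖x - y‖ ((1 + ‖x‖) / 2) with hc | hc
  · -- near case: flatness along the segment `[y, x]`
    set B : ℝ := 2 ^ M * D₁ / (1 + ‖x‖) ^ M with hB_def
    have hB : ∀ z ∈ segment ℝ y x, ‖iteratedFDeriv ℝ N f z‖ ≤ B := by
      intro z hz
      have hxz : ‖x - z‖ ≤ ‖x - y‖ := by
        have h : z ∈ closedBall x (dist y x) :=
          (convex_closedBall x (dist y x)).segment_subset (mem_closedBall.2 le_rfl)
            (mem_closedBall_self dist_nonneg) hz
        rwa [mem_closedBall, dist_eq_norm, dist_eq_norm, norm_sub_rev z x,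
          norm_sub_rev y x] at h
      have hz1 : (1 + ‖x‖) / 2 ≤ 1 + ‖z‖ := by
        have : ‖x‖ - ‖z‖ ≤ ‖x - z‖ := norm_sub_norm_le x z
        linarith
      have hpow : (1 + ‖x‖) ^ M ≤ 2 ^ M * (1 + ‖z‖) ^ M := by
        rw [← mul_pow]
        exact pow_le_pow_left₀ hxpos.le (by linarith) M
      rw [hB_def, le_div_iff₀ (by positivity)]
      calc ‖iteratedFDeriv ℝ N f z‖ * (1 + ‖x‖) ^ M
          ≤ ‖iteratedFDeriv ℝ N f z‖ * (2 ^ M * (1 + ‖z‖) ^ M) :=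
            mul_le_mul_of_nonneg_left hpow (norm_nonneg _)
        _ = 2 ^ M * ((1 + ‖z‖) ^ M * ‖iteratedFDeriv ℝ N f z‖) := by ring
        _ ≤ 2 ^ M * D₁ := mul_le_mul_of_nonneg_left (hD₁ z) (by positivity)
    have hflat := norm_iteratedFDeriv_le_of_notMem_tsupport (f.smooth ⊤) hy hB N 0 rfl x
      (right_mem_segment ℝ y x)
    rw [norm_iteratedFDeriv_zero, Real.norm_eq_abs] at hflat
    have hBx : B * (1 + ‖x‖) ^ M = 2 ^ M * D₁ := by
      rw [hB_def]; exact div_mul_cancel₀ _ (by positivity)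
    calc |f x| * (1 + ‖x‖) ^ M ≤ B * ‖x - y‖ ^ N * (1 + ‖x‖) ^ M :=
          mul_le_mul_of_nonneg_right hflat (by positivity)
      _ = 2 ^ M * D₁ * ‖x - y‖ ^ N := by rw [mul_right_comm, hBx]
      _ ≤ (2 ^ M * D₁ + 2 ^ N * D₀) * ‖x - y‖ ^ N := by
          apply mul_le_mul_of_nonneg_right _ (by positivity)
          nlinarith [pow_nonneg (zero_le_two (α := ℝ)) N]
  · -- far case: the plain weighted sup bound
    have h2 : 1 ≤ 2 * ‖x - y‖ := by nlinarith [norm_nonneg x]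
    have hpow : 1 ≤ 2 ^ N * ‖x - y‖ ^ N := by
      rw [← mul_pow]; exact one_le_pow₀ h2
    calc |f x| * (1 + ‖x‖) ^ M ≤ D₀ := hfx
      _ ≤ D₀ * (2 ^ N * ‖x - y‖ ^ N) := le_mul_of_one_le_right hD₀0 hpow
      _ = 2 ^ N * D₀ * ‖x - y‖ ^ N := by ring
      _ ≤ (2 ^ M * D₁ + 2 ^ N * D₀) * ‖x - y‖ ^ N := by
          apply mul_le_mul_of_nonneg_right _ (by positivity)
          nlinarith [pow_nonneg (zero_le_two (α := ℝ)) M]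

end Summit.QuantumFields.YangMills.Theorems.SelfNormalisedSkewness.Negative

end
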